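import Literature.AnabelianGeometry.SemiGraphs.InterfaceVocab
import Literature.AnabelianGeometry.SemiGraphs.SgALocalizations
import Literature.AnabelianGeometry.SemiGraphs.AmbientArrowClassesLaws
import Literature.AnabelianGeometry.SemiGraphs.SemiGraphBranches

/-!
# `SemiAnbdVocab.ofReal`: the §§4–5 container at the real vocabulary ([SemiAnbd] §§1–4) — merge step M7

Mochizuki, *Semi-graphs of anabelioids*, Publ. RIMS **42** (2006), §1 pp.11–14, §2 Defs 2.1–2.4
pp.22–26, Rmk 2.4.2 p.26, §4 Def 4.1–4.2 pp.50–52 (kurims `paper:url-f33ace170ff4`).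
[cite: MochizukiSemiAnbd2006, Rmk 2.4.2, p. 26]

THE MERGE (cell ruling abc-iut-L3-lead 2026-08-25T18:12Z / 20:36Z, DISCHARGE-L3 §E t3): the
statements of [SemiAnbd] §4 (`Localizations*.lean`) and §5 (`Arithmetic*.lean`) are typed over the
hypothesis container `SemiAnbdVocab (Obj) [Category Obj]` (`InterfaceVocab.lean`).  This file
INSTANTIATES the container at the real vocabulary of the tree:

* `Obj := SgAQuot.SgA` — totally aloof, verticially slim semi-graphs of anabelioids (t1's
  `SemiGraphOfAnabelioids`) in which every edge abuts to a vertex, with locally open 1-morphisms up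
  to 2-isomorphism (Rmk 2.4.2; `HomCategory.lean`, `AmbientCategory.lean`);
* underlying semi-graphs, branches, coincidence maps, the maps of a morphism: t1's `SemiGraph`
  (`SemiGraph.lean`, `SemiGraphBranches.lean`);
* `G[v]`, `G[e]`, `G[b]` with all their natural and induced arrows and laws: `SgALocalizations.lean`
  (over `InducedAlong*.lean`, `Localization*.lean`, `InducedAlongInheritance.lean`);
* classes of objects (injective type, (quasi-)coherent, totally elevated / estranged / universally
  sub-coverticial): t1's `Commensurability.lean`, `Coverticial.lean`; classes of arrows (locally
  trivial, locally finite étale, finite étale coverings) and verticial degrees: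
  `AmbientArrowClasses.lean`, `AmbientArrowClassesLaws.lean` (over `Anabelioids/FiniteEtaleComposition`).

HONEST RESIDUAL (`SgA.BridgeResidual`, a PARAMETER of `ofReal`, never constructed here): exactly the
container data the tree cannot yet supply in t1's model —
(R1) the class of TEMPERED arrows `𝒢' → 𝒢` (Def 3.5 (ii)) with its two formal laws (finite étale ⇒
tempered ⇒ locally finite étale): tempered coverings live in t2's group-theoretic model
`ProfiniteSemiGraph` (`TemperedCoverings*.lean`); the arrow-level notion in t1's model and the
dictionary are bridge debt (covering lineage L3-t5/t6/t9/t12);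
(R2) `Out(π̂₁(G_v))` as a PROFINITE group and the outer representation of `Aut(G)_v` on it
(Def 5.1 (i)(c); [IUTchI] Rmk 2.5.3 (vi) (O2) "the natural profinite topology" — needs `Aut` of a
topologically finitely generated profinite group as a profinite group, absent from Mathlib/tree).
Every OTHER field of the container is real.  Consequently every §4–§5 declaration
`X 𝓥 …` specialises to the printed statement at `𝓥 := SemiAnbdVocab.ofReal R`, conditionally on
nothing but the residual data `R`.

Also: first `_iff` bridges between the container's derived combinatorics and t1's (`IsFinite`,
`IsCountable`, `IsGraph`, `HasNoIsolatedEdge` — the last holds for EVERY object of `SgA`).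
Further container-level merge debt NOT addressed here (recorded): `AnabelioidVocab`
(`LocalizationsAnabelioids.lean`), `LocalAdjectives` (`ArithmeticCoverings.lean`), `LocHypotheses`.
-/

namespace Literature.AnabelianGeometry.SemiGraphs

open CategoryTheory Literature.AnabelianGeometry.Anabelioids

universe v₁ u₁ u

namespace SgAQuot

namespace SgA

variable {X Y : SgA.{v₁, u₁, u}}

/-! ### Transports and the total branch arrows are locally trivial; induced arrows -/

/-- A transport `eqToHom` of the ambient category is locally trivial.
[cite: MochizukiSemiAnbd2006, Def 2.2 (ii), p. 24] -/
theorem locallyTrivial_eqToHom (p : X = Y) : locallyTrivial (eqToHom p : X ⟶ Y).hom.hom := by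
  subst p; exact id_mem_locallyTrivial _

/-- A transport `eqToHom` of the ambient category is locally finite étale.
[cite: MochizukiSemiAnbd2006, Def 2.2 (ii), p. 24] -/
theorem locallyFiniteEtale_eqToHom (p : X = Y) :
    locallyFiniteEtale (eqToHom p : X ⟶ Y).hom.hom :=
  locallyFiniteEtale_of_locallyTrivial (locallyTrivial_eqToHom p)

/-- `X[v] → X` is locally trivial. [cite: MochizukiSemiAnbd2006, Def 4.1, p. 50] -/
theorem locallyTrivial_ιV (X : SgA.{v₁, u₁, u}) (v : X.toSgA.graph.Vertex) :
    locallyTrivial (X.ιV v).hom.hom :=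
  homOf_atVertexHom_mem_locallyTrivial X.toSgA v

/-- `X[e] → X` is locally trivial. [cite: MochizukiSemiAnbd2006, Def 4.1, p. 50] -/
theorem locallyTrivial_ιE (X : SgA.{v₁, u₁, u}) (e : X.toSgA.graph.Edge) :
    locallyTrivial (X.ιE e).hom.hom :=
  homOf_atEdgeHom_mem_locallyTrivial X.toSgA e

/-- `X[b] → X[v]` (total form) is locally trivial. [cite: MochizukiSemiAnbd2006, Def 4.1, p. 50] -/
theorem locallyTrivial_βV (X : SgA.{v₁, u₁, u}) (b : X.toSgA.graph.Branch) (v : X.toSgA.graph.Vertex)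
    (h : X.toSgA.graph.abuts b = some v) : locallyTrivial (X.βV b v h).hom.hom := by
  rw [βV, comp_hom_hom, comp_hom_hom]
  exact comp_mem_locallyTrivial (locallyTrivial_eqToHom _)
    (comp_mem_locallyTrivial (homOf_atBranchToAtVertex_mem_locallyTrivial X.toSgA b _)
      (locallyTrivial_eqToHom _))

/-- `X[b] → X[e_b]` (total form) is locally trivial. [cite: MochizukiSemiAnbd2006, Def 4.1, p. 50] -/
theorem locallyTrivial_βE (X : SgA.{v₁, u₁, u}) (b : X.toSgA.graph.Branch) :
    locallyTrivial (X.βE b).hom.hom := by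
  by_cases hb : (X.toSgA.graph.abuts b).isSome
  · rw [βE, dif_pos hb, comp_hom_hom]
    exact comp_mem_locallyTrivial (locallyTrivial_eqToHom _)
      (homOf_atBranchToAtEdge_mem_locallyTrivial X.toSgA b hb)
  · rw [βE, dif_neg hb]
    exact locallyTrivial_eqToHom _

/-- The induced `X[v] → Y[w]` of a locally finite étale arrow is locally finite étale.
[cite: MochizukiSemiAnbd2006, Def 4.1 (iv), p. 51] -/
theorem locallyFiniteEtale_locMapV (F : X ⟶ Y) (hF : locallyFiniteEtale F.hom.hom)
    (v : X.toSgA.graph.Vertex) (w : Y.toSgA.graph.Vertex) (h : F.hom.hom.base.vertexMap v = w) :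
    locallyFiniteEtale (locMapV F v w h).hom.hom := by
  rw [locMapV, comp_hom_hom, homMk'_hom_hom]
  exact comp_mem_locallyFiniteEtale (atVertexMap_mem_locallyFiniteEtale _ hF v)
    (locallyFiniteEtale_eqToHom _)

/-- The induced `X[e] → Y[e']` of a locally finite étale arrow is locally finite étale.
[cite: MochizukiSemiAnbd2006, Def 4.1 (iv), p. 51] -/
theorem locallyFiniteEtale_locMapE (F : X ⟶ Y) (hF : locallyFiniteEtale F.hom.hom)
    (e : X.toSgA.graph.Edge) (e' : Y.toSgA.graph.Edge) (h : F.hom.hom.base.edgeMap e = e') :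
    locallyFiniteEtale (locMapE F e e' h).hom.hom := by
  rw [locMapE, comp_hom_hom, homMk'_hom_hom]
  exact comp_mem_locallyFiniteEtale (atEdgeMap_mem_locallyFiniteEtale _ hF e)
    (locallyFiniteEtale_eqToHom _)

/-- Retargeting commutes with `X[e] → X`. [cite: MochizukiSemiAnbd2006, Def 4.1, p. 50] -/
theorem eqToHom_comp_ιE (X : SgA.{v₁, u₁, u}) {e e' : X.toSgA.graph.Edge} (h : e = e') :
    eqToHom (congrArg X.atEdge h) ≫ X.ιE e' = X.ιE e := by
  subst h; exact Category.id_comp _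

/-! ### The residual of the bridge -/

-- justification: as for `SgAQuot` / `SgA` (`HomCategory.lean`, `AmbientCategory.lean`), the three
-- universes of t1's `SemiGraphOfAnabelioids` occur only together in the type of `SgA`.
set_option linter.checkUnivs false in
/-- **The honest residual of the L3 bridge**: the container data of `SemiAnbdVocab`
(`InterfaceVocab.lean`) that the tree does not yet supply in t1's model of semi-graphs of
anabelioids — (R1) the class of *tempered* arrows `𝒢' → 𝒢` ([SemiAnbd] Def 3.5 (ii) p.37: a
covering of a countable `𝒢` split componentwise by some finite étale covering; "we shall say that the
covering `𝒢' → 𝒢`, as well as the object of `B^cov(𝒢)` that gave rise to this covering, is *tempered*";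
coverings `B^cov` are typed in t2's `ProfiniteSemiGraph` model only) with the two formal laws: finite
étale ⇒ tempered (`B(G) ↪ B^temp(G)`, p.37) and tempered ⇒ locally finite étale (Rmk 3.5.2);
(R2) `Out(π̂₁(G_v))` as
a profinite group — Def 2.3 (iii) p.25 "is equipped with a natural profinite group structure" (for
topologically finitely generated `π̂₁(G_v)`), used with "the natural profinite group topology" in
Def 5.1 (i)(c) p.62 (cf. [IUTchI] Rmk 2.5.3 (vi) (O2)) — and the outer representation of the
automorphisms of `G` fixing `v` on it.  A PARAMETER of `SemiAnbdVocab.ofReal`; nothing is asserted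
about it.  (Docstring loci re-cited per referee finding E13-F11; declarations unchanged.)
[cite: MochizukiSemiAnbd2006, Def 3.5 (ii), p. 37] -/
structure BridgeResidual where
  /-- (R1) tempered arrows `𝒢' → 𝒢` (Def 3.5 (ii), p.37) -/
  IsTempered : ∀ {G H : SgA.{v₁, u₁, u}}, (G ⟶ H) → Prop
  /-- (R1) `B(G) ↪ B^temp(G)`: finite étale coverings are tempered (Def 3.5 (ii), p.37) -/
  isTempered_of_finiteEtale : ∀ {G H : SgA.{v₁, u₁, u}} (f : G ⟶ H),
    finiteEtale f.hom.hom → IsTempered f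
  /-- (R1) tempered coverings are locally finite étale (Def 3.5 (ii) with Rmk 3.5.2, p.38) -/
  locallyFiniteEtale_of_isTempered : ∀ {G H : SgA.{v₁, u₁, u}} (f : G ⟶ H),
    IsTempered f → locallyFiniteEtale f.hom.hom
  /-- (R2) `Out(π̂₁(G_v))` with its natural profinite topology (Def 5.1 (i)(c), p.62) -/
  OutVert : (G : SgA.{v₁, u₁, u}) → G.toSgA.graph.Vertex → ProfiniteGrp.{u}
  /-- (R2) the outer automorphism of `π̂₁(G_v)` induced by an automorphism of `G` fixing `v`
  (Def 5.1 (i)(c), p.62) -/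
  outRep : ∀ {G : SgA.{v₁, u₁, u}} (φ : Aut G) (v : G.toSgA.graph.Vertex),
    φ.hom.hom.hom.base.vertexMap v = v → OutVert G v

end SgA

end SgAQuot

/-! ### The container at the real vocabulary -/

open SgAQuot SgAQuot.SgA SemiGraphOfAnabelioids in
/-- **`SemiAnbdVocab.ofReal`: the §§4–5 hypothesis container instantiated at the real vocabulary of
the tree** (`Obj := SgA`; see the module docstring for the dictionary), modulo the honest residual
`R` (tempered arrows; profinite `Out(π̂₁(G_v))`).  Every declaration of `Localizations*.lean` /
`Arithmetic*.lean` parametrised by `(𝓥 : SemiAnbdVocab Obj)` specialises at this term to the printed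
statement about totally aloof, verticially slim semi-graphs of anabelioids and their locally open
morphisms (Rmk 2.4.2). [cite: MochizukiSemiAnbd2006, Rmk 2.4.2, p. 26] -/
noncomputable def SemiAnbdVocab.ofReal (R : SgA.BridgeResidual.{v₁, u₁, u}) :
    SemiAnbdVocab SgA.{v₁, u₁, u} where
  Vert G := G.toSgA.graph.Vertex
  Edge G := G.toSgA.graph.Edge
  Br {G} e := G.toSgA.graph.branchesOf e
  abut {G} {_} b := G.toSgA.graph.abuts b.1
  natCard_br {G} e := G.toSgA.graph.natCard_branchesOf e
  mapV {_ _} f := f.hom.hom.base.vertexMap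
  mapE {_ _} f := f.hom.hom.base.edgeMap
  mapBr {_ _} f {e} b := SemiGraph.Hom.branchesOfMap f.hom.hom.base e b
  mapBr_bijective {_ _} f e := SemiGraph.Hom.branchesOfMap_bijective f.hom.hom.base e
  abut_mapBr {_ _} f {_} b v h := SemiGraph.Hom.abuts_branchesOfMap f.hom.hom.base b v h
  mapV_id _ _ := rfl
  mapV_comp {_ _ _} _ _ _ := rfl
  mapE_id _ _ := rfl
  mapE_comp {_ _ _} _ _ _ := rfl
  locV G v := G.atVertex v
  locE G e := G.atEdge e
  locB G {_} b := G.atBranch? b.1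
  ιV G v := G.ιV v
  ιE G e := G.ιE e
  ιB G {_} b := G.ιB b.1
  βV G {_} b v h := G.βV b.1 v h
  βE G {e} b := G.βE b.1 ≫ eqToHom (congrArg G.atEdge b.2)
  βV_ι G {_} b v h := G.βV_ι b.1 v h
  βE_ι G {e} b := by
    rw [Category.assoc, G.eqToHom_comp_ιE b.2]
    exact G.βE_ι b.1
  centerV G v := G.centerV v
  mapV_centerV G v := G.ιV_vertexMap_centerV v
  centerE G e := G.centerE e
  mapE_centerE G e := G.ιE_edgeMap_centerE e
  locMapV {_ _} f v w h := SgA.locMapV f v w h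
  locMapE {_ _} f e e' h := SgA.locMapE f e e' h
  locMapV_ι {_ _} f v w h := SgA.locMapV_ι f v w h
  locMapE_ι {_ _} f e e' h := SgA.locMapE_ι f e e' h
  locMapV_id G v h := SgA.locMapV_id G v h
  locMapV_comp {_ _ _} f g v w x h₁ h₂ h₃ := SgA.locMapV_comp f g v w x h₁ h₂ h₃
  locMapE_id G e h := SgA.locMapE_id G e h
  locMapE_comp {_ _ _} f g e e' e'' h₁ h₂ h₃ := SgA.locMapE_comp f g e e' e'' h₁ h₂ h₃
  vertDegree {_ _} f v := SgAQuot.Hom.vertDegree f.hom.hom v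
  OutVert := R.OutVert
  outRep {_} φ v h := R.outRep φ v h
  IsOfInjectiveType G := G.toSgA.IsOfInjectiveType
  IsQuasiCoherent G := G.toSgA.IsQuasiCoherent
  IsCoherent G := G.toSgA.IsCoherent
  isQuasiCoherent_of_isCoherent _ h := h.isQuasiCoherent
  IsTotallyElevated G := G.toSgA.IsTotallyElevated
  IsTotallyUnivSubcoverticial G := G.toSgA.IsTotallyUniversallySubCoverticial
  IsTotallyEstranged G := G.toSgA.IsTotallyEstranged
  IsLocallyTrivial {_ _} f := locallyTrivial f.hom.hom
  IsLocallyFiniteEtale {_ _} f := locallyFiniteEtale f.hom.hom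
  IsFiniteEtale {_ _} f := finiteEtale f.hom.hom
  IsTempered {_ _} f := R.IsTempered f
  isLocallyFiniteEtale_of_isLocallyTrivial {_ _} _ h := locallyFiniteEtale_of_locallyTrivial h
  isLocallyFiniteEtale_of_isFiniteEtale {_ _} _ h := locallyFiniteEtale_of_finiteEtale h
  isTempered_of_isFiniteEtale {_ _} f h := R.isTempered_of_finiteEtale f h
  isLocallyFiniteEtale_of_isTempered {_ _} f h := R.locallyFiniteEtale_of_isTempered f h
  isLocallyTrivial_id G := id_mem_locallyTrivial G.obj.obj
  isLocallyFiniteEtale_comp {_ _ _} _ _ hf hg := comp_mem_locallyFiniteEtale hf hg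
  isLocallyTrivial_ιV G v := G.locallyTrivial_ιV v
  isLocallyTrivial_ιE G e := G.locallyTrivial_ιE e
  isLocallyTrivial_βV G {_} b v h := G.locallyTrivial_βV b.1 v h
  isLocallyTrivial_βE G {_} b := by
    rw [SgA.comp_hom_hom]
    exact comp_mem_locallyTrivial (G.locallyTrivial_βE b.1) (SgA.locallyTrivial_eqToHom _)
  isLocallyFiniteEtale_locMapV {_ _} f v w h hf := SgA.locallyFiniteEtale_locMapV f hf v w h
  isLocallyFiniteEtale_locMapE {_ _} f e e' h hf := SgA.locallyFiniteEtale_locMapE f hf e e' h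

namespace SemiAnbdVocab

open SgAQuot SgAQuot.SgA

variable (R : SgA.BridgeResidual.{v₁, u₁, u})

/-! ### First dictionary entries between the container's derived combinatorics and t1's -/

/-- At the real vocabulary, the container's "finite" is t1's `SemiGraph.IsFinite`.
[cite: MochizukiSemiAnbd2006, §1, p. 11] -/
theorem ofReal_isFinite_iff (G : SgA.{v₁, u₁, u}) :
    (SemiAnbdVocab.ofReal R).IsFinite G ↔ G.toSgA.graph.IsFinite := by
  rw [SemiGraph.isFinite_iff]; rfl

/-- At the real vocabulary, the container's "countable" is t1's `SemiGraph.IsCountable`.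
[cite: MochizukiSemiAnbd2006, §1, p. 11] -/
theorem ofReal_isCountable_iff (G : SgA.{v₁, u₁, u}) :
    (SemiAnbdVocab.ofReal R).IsCountable G ↔ G.toSgA.graph.IsCountable := by
  rw [SemiGraph.isCountable_iff]; rfl

/-- At the real vocabulary, the container's "graph" (every edge closed) is t1's `SemiGraph.IsGraph`
(every branch abuts). [cite: MochizukiSemiAnbd2006, §1, p. 11] -/
theorem ofReal_isGraph_iff (G : SgA.{v₁, u₁, u}) :
    (SemiAnbdVocab.ofReal R).IsGraph G ↔ G.toSgA.graph.IsGraph := by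
  rw [SemiGraph.isGraph_iff]
  constructor
  · intro h b
    exact h (G.toSgA.graph.edgeOf b) ⟨b, rfl⟩
  · intro h e b
    exact h b.1

/-- At the real vocabulary, "injective on vertices" (Def 4.2 (ii)) is injectivity of the vertex map
of the underlying morphism of semi-graphs. [cite: MochizukiSemiAnbd2006, Def 4.2 (ii), p. 52] -/
theorem ofReal_isInjOnVertices_iff {G H : SgA.{v₁, u₁, u}} (f : G ⟶ H) :
    (SemiAnbdVocab.ofReal R).IsInjOnVertices f ↔ Function.Injective f.hom.hom.base.vertexMap :=
  Iff.rfl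

/-- **Every object of the ambient category satisfies the [IUTchI] Rmk 2.5.3 (iii) hypothesis "every
edge abuts to at least one vertex"** (container predicate `HasNoIsolatedEdge`), by the definition of
`SgA`. [cite: Mochizuki2012, IUTchI Rmk 2.5.3 (iii), p. 54] [claim: Mochizuki2012, status: disputed] -/
theorem ofReal_hasNoIsolatedEdge (G : SgA.{v₁, u₁, u}) :
    (SemiAnbdVocab.ofReal R).HasNoIsolatedEdge G := by
  intro e he
  obtain ⟨b, v, hbe, hbv⟩ := G.everyEdgeAbuts e
  have := he ⟨b, hbe⟩
  change G.toSgA.graph.abuts b = none at this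
  rw [hbv] at this
  cases this

end SemiAnbdVocab

end Literature.AnabelianGeometry.SemiGraphs
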